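import Literature.MathematicalPhysics.QuantumFieldTheory.Balaban1983to89.B9Eq369Small

/-!
# `Balaban1983to89.B9Eq369Product` — B9, p. 404: the plaquette variable of the PRODUCT configuration `U′U` of (3.37),
# `|(U′U)(∂p) − 1|, |Re(U′U)(∂p) − 1|, |Im(U′U)(∂p)| ≤ O(1)(C₀ + α₁)ξ²` «directly from the assumptions (3.35), (3.37)», with
# every `O(1)` explicit, and the local bound (3.69) for `Δ′(U′U)`; kernel-checked; v1.1

CITATION HEADER (lean-in-tree rule).  Audit cell `pub-balaban`, surge node-prover lineage pv27 (B9 pp. 390–392, 396–397, 404),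
unit `b2b-balaban-pv27-g18` (journal CLAIM l.54889, node B9-EQ369-PRODUCT).  Source: T. Bałaban, *Propagators for lattice gauge
theories in a background field*, Commun. Math. Phys. **99** (1985) 389–434 [Balaban1985BackgroundPropagators] (cell paper B9;
journal page = PDF page + 388), p. 404 [PDF 16], p. 396 [PDF 8], p. 397 [PDF 9], p. 390 [PDF 2], p. 391 [PDF 3], quoted from the
page renders `b2b-balaban-ref1/pages/1985-cmp99-background-propagators/…-p016-x2.png`, `…-p008-x2.png`, `…-p009-x2.png`,
`…-p002-x2.png`, `…-p003-x2.png` READ AS IMAGES by this lineage (2026-08-19); the displays (3.1)–(3.12) are quoted in full in the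
headers of the lineage leaves `B9Eq37Insertion`, `B9Eq39Adjoint`, `B9Eq310Hermitian`, the (3.69) passage in `B9Eq369Small`
(all imported BY NAME, transitively, through the single import `B9Eq369Small`).

HONEST FRAMING (cell charter, verbatim in substance).  The cell audits Bałaban's papers; discharging its end statements would
make Bałaban's ultraviolet stability theorem unconditional inside this package — a constructive-QFT statement; it is NOT the
continuum limit and NOT the Clay problem.  THIS FILE DISCHARGES NOTHING of the series: it is the four-exponential expansion of one
plaquette word plus real arithmetic, on top of (i) the lineage leaf `B9Eq369Small` (imported BY NAME: `norm_reC_sub_one_le`,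
`norm_imC_le` — the display below (3.69) for a unit `W` with `‖W⁻¹‖ ≤ r`; `Through` = `st(b)`; `norm_deltaPrimeOp_le_local`,
`eq369_local_rho`, `xi_sq_div_eta_sq`, `plaqU_inv_val`, `norm_plaqU_inv_le`, `plaqU_one`), through it `B9Eq310Hermitian`
(`deltaPrimeOp` = the operator `Δ′` of (3.10), `zP`, `yP`), `B9Eq39Adjoint` (`R`, `covD`, `curl`, `plaqU`, the product configuration
`prodCfg U η A′ = (b ↦ e^{iηA′(b)}·U(b))`, `fluct`, `prodCfg`'s traced plaquette word `wil_plaqU_prodCfg`), `B9Eq37Insertion` (`reC`,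
`imC`, `holU`), and (ii) the sub-cell b12 leaf `B12Membership314` (imported through `B9Eq39Adjoint`; BY NAME:
`plaquette_mul_background` — the factorisation of the word —, `norm_plaquette_expMul_sub_one_le` — its norm expansion: first order
+ `elem343` + dressed background —, `norm_dressed_le`, `norm_mul_exp_le`, `norm_I_mul_smul`), with `Beta.TransportVertices.norm_exp_mul_le`.
`B9Eq369Small` proved (3.69) from the plaquette smallness `‖U(∂p) − 1‖ ≤ ε` as a HYPOTHESIS and listed under NOT PROVED «the
regularity conditions (3.35)–(3.38) ⟹ ‖(U′U)(∂p) − 1‖ ≤ O(1)(Mα₀ + α₁)ξ² (for U′ = 1 see `B9Eq335Plaquette`; for U′ ≠ 1 not in the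
tree)».  This file proves that sentence for `U′ ≠ 1` — the case the print actually states (3.69) for — from the (3.37)-type bounds on
`A′` at the plaquette and the OUTPUT of (3.35) for the background plaquette, and composes it with the local theorem to (3.69) for
`Δ′(U′U)`.  Value = kernel certificate that the printed «follow directly from the assumptions (3.35), (3.37)» is a two-step
consequence of the plaquette word (3.1) and the covariant-derivative dictionary (3.2), with the print's `O(1)` explicit, importable
BY NAME by the (3.69) consumers for the COMPLEX configurations `U′U` they quantify over; NOT summit progress.

ABSOLUTE RULE.  No internally-minted statement enters as a cited fact.  Every declaration below is PROVED (tags `[folklore]`);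
the `[cite: …]` tags document WHICH PRINTED DISPLAY a definition or a proved statement transcribes — the proofs are ours, the
print is not used as a hypothesis anywhere.  The two regularity inputs are HYPOTHESES with explicit constants as binders: (3.37)
at a plaquette `p = p_{κν}(y)` as `‖A′_κ(y)‖, ‖A′_ν(y)‖ ≤ α₁(L^jη)⁻¹` and `‖(D¹_{U,κ}A′_ν)(y)‖, ‖(D¹_{U,ν}A′_κ)(y)‖ ≤ η·α₁(L^jη)⁻²`
(`D¹ = covD = η·∇^η_U`, `norm_eta_inv_smul_le_iff`), and (3.35) through its OUTPUT `‖U(∂p) − 1‖ ≤ C₀·L^{−2j}` for the background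
plaquette (`C₀` = the print's `O(1)Mα₀`-constant; the step (3.35) ⟹ this, incl. the gauge invariance of `‖U(∂p) − 1‖`, is the
sub-cell b09 leaf `B9Eq335Plaquette` — `b7_52_of_b9_335`, `norm_conj_sub_one_eq` — tree, accepted, NOT imported (different carrier:
four abstract exponentials in a `NormOneClass` ℚ-normed algebra) and NOT re-derived; NOTE that the present file's §3 with `U ≡ 1`,
`C₀ = 0` is itself a (3.35) ⟹ `‖e^{iηA}(∂p) − 1‖ ≤ e^{6cξ}(2c + 18c²)ξ²` certificate in the gauge `u`, `c = O(1)Mα₀`, see §6).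

WHAT IS IN PRINT («…» verbatim from the renders; [sic] marks print as printed).
* p. 404 [PDF 16], lines 4–16 (the (3.69) passage, quoted in full in `B9Eq369Small`): «Let us consider at first the operator
  Δ(U′U). It is a sum of two operators, Δ(U′U) = D*_{U′U}D_{U′U} + Δ′(U′U). From the formula (3.10) it follows that Δ′(U′U) is a
  small perturbation itself in the sense that we have the bound |(Δ′(U′U)A′)(b)| ≤ O(1)(Mα₀ + α₁)(L^jη)⁻²|A′|, b ∈ Ω_j (3.69) the
  supremum on the right-hand side is taken over bonds belonging to one of the plaquettes containing the bond b (i.e. we have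
  max_{b′:b′⊂∂p,p∈st(b)}|A′(b′)| …). This bound follows from the estimates |Re(U′U)(∂p) − 1|, |Im(U′U)(∂p)| ≤ O(1)(Mα₀ + α₁)ξ²,
  ξ = L^{−j}. Let us recall that the operations Re and Im in this case were defined after formula (3.7), and the estimates follow
  directly from the assumptions (3.35), (3.37). It is easy to see that for the difference Δ′(U′U) − Δ′(U) we have a bound similar
  to (3.69), but with additional factor α₁. It is not essential in the sequal [sic].»
* p. 396 [PDF 8]: «big blocks of the lattice T_{L−j} [sic], which implies that its size in the lattice T_η is O(1)ML^jη. Here O(1)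
  will mean a number ≥ 10.» … the regularity condition: «for an arbitrary cube □ of the described above class, and for a
  configuration U there exists a gauge transformation u on □ such that U^u = e^{iηA}. [sic] and if the index of □ is j, then
  |A| < O(1)Mα₀(L^jη)⁻¹, |∇^ηA| < O(1)Mα₀(L^jη)⁻² on □, where O(1)M is a size of □ in T_{L−j} [sic]; (3.35)» … «We have to
  consider operators extended to configurations U with values in the complexified group G^c. We may define regularity conditions
  for such configurations in the same way, i.e. by the conditions (3.35), (3.36). Instead we specify somewhat more the class of
  configurations considered. We assume that they have the form U′U, where U has values in G and U′ = e^{iηA′}, A′ ∈ g^c. For a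
  given pair of positive numbers α₀, α₁ we consider the class of these configurations satisfying: U satisfies the condition
  (3.35), and |A′| < α₁(L^jη)⁻¹, |∇^η_U A′| < α₁(L^jη)⁻² on Ω_j, j = 0,…,k; (3.37)» … «We will prove in another paper that if U′U
  satisfies the conditions (3.37), (3.38),» — p. 397 [PDF 9]: «then it satisfies also (3.35), (3.36) with α₀ replaced by
  O(1)(α₀ + α₁), but we will not use this fact here.» … «Thus we have the supremum norms |A| = max_μ sup_x |A_μ(x)|,
  |∇A| = max_{μ,ν} sup_x |(D_μA_ν)(x)|, (3.39)».
* p. 390 [PDF 2] (3.1): «tr(U′U₀)(∂p) = tr(∂₀U′)((p)_z)U₀(∂p), where for a plaquette p = ⟨x, y, z, w⟩ we define (p)_z = ⟨z, w, x, y⟩,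
  and (∂₀U′)((p)_z) = R(U₀(x,w))U′(z,w)U′(w,x)U′(x,y)R(U₀(x,y))U′(y,z). Let us recall that R(U)X = UXU⁻¹.»; «We take U = U′U₀,
  U′ = exp iηA»; under (3.2): «A′(z,w) = R(U₀(x,w))A(z,w), A′(w,x) = A(w,x), A′(x,y) = A(x,y), A′(y,z) = R(U₀(x,y))·A(y,z)»; «For a
  matrix valued function A defined at points of the lattice we put (D^η_{U₀}A)(b) = η⁻¹(R(U₀(b))A(b₊) − A(b₋)),» — p. 391 [PDF 3]
  the UNNUMBERED display after (3.4): «(D^η_{U₀}A)(p_{μν}(x)) = (D^η_{U₀}A)_{μν}(x) = (D^η_{U₀,μ}A_ν)(x) − (D^η_{U₀,ν}A_μ)(x)» ((3.4) itself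
  is the four-letter plaquette form «(D^η_{U₀}A)(p) = η⁻¹(A(x, y) + R(U₀(x, y))A(y, z) + R(U₀(x, w))A(z, w) + A(w, x))»); (3.5): «U(x,x′) = U⁻¹(x′,x),
  A(x,x′) = −A(x′,x) for a bond ⟨x,x′⟩.»; (3.6): «(∂₀U′)((p)_z) = 1 + iη²(D^η_{U₀}A)(p) − ½η⁴((D^η_{U₀}A)(p))² + …»; after (3.7):
  «This expansion is valid also for configurations A and U₀ with values respectively in the complexified algebra g^c and the group
  G^c, we have to interpret only Re U₀(∂p) and Im U₀(∂p) as Re U₀(∂p) = ½(U₀(∂p) + U₀(−∂p)), Im U₀(∂p) = (1/2i)(U₀(∂p) − U₀(−∂p)).»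

WHAT THIS FILE PROVES.  MODEL (as in the lineage leaves): `𝔸` a complete normed ℂ-algebra (no commutativity, no `‖1‖ = 1`, no
unitarity), `R W X = W·X·W⁻¹`; sites `S`, directions `ι` (finite and linearly ordered where `Δ′` occurs), shifts `T μ : S ≃ S`
(bijections; NO commutation assumed), background `U : ι → S → 𝔸ˣ` (bond variables, ARBITRARY units; the transport size `ρ` with
`‖U(b)^{±1}‖ ≤ ρ` enters only in §5, `ρ = 1` for `G`-valued `U` in an operator norm), fluctuation field `A′ : ι → S → 𝔸`, product
configuration `prodCfg U η A′` = `(U′U)(b) = e^{iηA′(b)}U(b)`; the plaquette `p = p_{κν}(y)` with boundary bonds `(κ,y)`, `(ν,T κ y)`,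
`(κ,T ν y)`, `(ν,y)` and `U(∂p) = plaqU T U κ ν y`; norms = the `NormedRing` norm (the `|·|` of (3.39) per bond = a hypothesis per bond).
* §1 THE WORD.  `val_fluct`/`val_inv_fluct`/`val_prodCfg`/`val_inv_prodCfg` (`(U′U)(b)^{±1}` as algebra elements), `prodCfg_zero`
  (`A′ = 0 ⟹ U′U = U`), `norm_eta_inv_smul_le_iff` (the print's `η⁻¹` in `∇^η` vs the tree's `covD`); **`plaqU_prodCfg_val`** — (3.1)
  UNTRACED: `(U′U)(∂p) = e^{b₁}e^{R(U_κ(y))b₂}·U(∂p)·e^{−R(U_ν(y))b₃}e^{−b₄}`, `b₁ = iηA′_κ(y)`, `b₂ = iηA′_ν(y+e_κ)`, `b₃ = iηA′_κ(y+e_ν)`,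
  `b₄ = iηA′_ν(y)` (public lattice form of the private step in `wil_plaqU_prodCfg`); **`plaqU_prodCfg_inv_val`** — the reversed contour
  `(U′U)(∂p)⁻¹ = e^{b₄}e^{R(U_ν(y))b₃}·U(∂p)⁻¹·e^{−R(U_κ(y))b₂}e^{−b₁}`.
* §2 THE DICTIONARY (3.2) ↔ covariant derivative: `R_far_eq` `R(U_κ(y))A′_ν(y+e_κ) = A′_ν(y) + (D¹_{U,κ}A′_ν)(y)`;
  `far_sub_near_eq_curl` (the first-order letter combination IS `(D¹_U A′)(p)`, the display after (3.4)); `norm_R_far_le` — a transported far letter is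
  bounded by `‖A′_ν(y)‖ + ‖(D¹_{U,κ}A′_ν)(y)‖` WITHOUT any norm hypothesis on `U`.
* §3 **THE SENTENCE.**  `letterSize` `S(p) = ‖A′_κ(y)‖ + ‖R(U_κ(y))A′_ν(y+e_κ)‖ + ‖R(U_ν(y))A′_κ(y+e_ν)‖ + ‖A′_ν(y)‖`;
  **`norm_plaqU_prodCfg_sub_one_le`** (general, `η ≥ 0`): `‖(U′U)(∂p) − 1‖ ≤ η‖(D¹_U A′)(p)‖ + ½S(p)²η²e^{ηS(p)} + e^{ηS(p)}‖U(∂p) − 1‖`;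
  `norm_plaqU_prodCfg_sub_one_le_of_bounds` (letters `a₁`, `g`, `ε₀`: `≤ 2ηg + ½(4a₁+2g)²η²e^{η(4a₁+2g)} + e^{η(4a₁+2g)}ε₀`); the budget
  `budget_xi`; **`norm_plaqU_prodCfg_sub_one_le_xi`** (scale `ℓ ≥ η > 0`, `ξ = η/ℓ`): (3.37) at `p` + `‖U(∂p) − 1‖ ≤ C₀ξ²` ⟹
  `‖(U′U)(∂p) − 1‖ ≤ e^{6α₁ξ}(C₀ + 2α₁ + 18α₁²)ξ²`; **`norm_plaqU_prodCfg_sub_one_le_printed`** (`ℓ = L^jη`, `L ≥ 1`, `eta_div_scale`: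
  `ξ = L^{−j}`): `≤ e^{6α₁}(C₀ + 2α₁ + 18α₁²)·L^{−2j}`; `const_linear_shape`: for `0 ≤ α₁ ≤ 1`, `0 ≤ C₀` this constant is
  `≤ 20e⁶(C₀ + α₁)` — the print's `O(1)(Mα₀ + α₁)ξ²` with `C₀ = O(1)Mα₀` and `O(1) = 20e⁶` (no sign hypotheses are needed elsewhere:
  `0 ≤ α₁`, `0 ≤ C₀ξ²` follow from the hypotheses being norm bounds).
* §4 **THE DISPLAY.**  `norm_plaqU_prodCfg_inv_le` `‖(U′U)(∂p)⁻¹‖ ≤ e^{ηS(p)}‖U(∂p)⁻¹‖`; `norm_reC_prodCfg_sub_one_le`, `norm_imC_prodCfg_le`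
  (`‖U(∂p)⁻¹‖ ≤ r₀` ⟹ `|Re(U′U)(∂p) − 1|, |Im(U′U)(∂p)| ≤ ½(1 + e^{ηS(p)}r₀)‖(U′U)(∂p) − 1‖`); `eta_mul_letterSize_le` (`ηS(p) ≤ 6α₁`
  under (3.37) at `p`); **`re_im_prodCfg_le_printed`**: `|Re(U′U)(∂p) − 1|, |Im(U′U)(∂p)| ≤ ½(1 + e^{6α₁}r₀)·e^{6α₁}(C₀ + 2α₁ + 18α₁²)·L^{−2j}`
  (`r₀ = 1` for `G`-valued `U`: `B9Eq369Small.norm_plaqU_inv_le_one`).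
* §5 **(3.69) FOR `U′U`.**  `norm_prodCfg_le`: `η‖A′(b)‖ ≤ s`, `‖U(b)^{±1}‖ ≤ ρ` ⟹ `‖(U′U)(b)^{±1}‖ ≤ e^{s}ρ` (the transport size of the
  complex configuration; `s = α₁` is (3.37) on `Ω₀`); **`eq369_prodCfg`**: with `ρ′ = e^{s}ρ`, (3.37) and the (3.35)-output on every
  `p ∈ st(b)` and `‖A(b′)‖ ≤ a` on their boundary bonds,
  `‖(Δ′(U′U)A)(b)‖ ≤ 14(d−1)·ρ′⁴·½(1+ρ′⁴)·e^{6α₁}(C₀ + 2α₁ + 18α₁²)·(L^jη)⁻²·a` (`B9Eq369Small.eq369_local_rho` applied to `prodCfg`);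
  **`eq369_prodCfg_group`** (`ρ = 1`, `s = α₁`): `≤ 14(d−1)·e^{4α₁}·½(1+e^{4α₁})·e^{6α₁}(C₀ + 2α₁ + 18α₁²)·(L^jη)⁻²·a` — (3.69) for the
  configurations `U′U` of (3.37) with every `O(1)` explicit.
* §6 SANITY: `A′ = 0` gives back the background plaquette and `eq369_prodCfg_group` specialises to `B9Eq369Small.eq369`'s conclusion
  LETTER FOR LETTER (an `example`); `U ≡ 1` gives the pure-fluctuation plaquette bound `‖U′(∂p) − 1‖ ≤ η‖(D¹A′)(p)‖ + ½S²η²e^{ηS}` with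
  the flat curl (B7 (52)'s shape; with the (3.35) letters this is the in-gauge form of (3.35) ⟹ `‖U^u(∂p) − 1‖ ≤ O(1)Mα₀·ξ²`).

RELATED IN THE TREE, NOT DUPLICATED (searched 2026-08-19: MODULE-MAP rows B7/B9/B12, `grep -rln "prodCfg\|U′U\|plaquette_mul_background"
Balaban1983to89/`): `B12Membership314` (b12) = the ENGINE at one plaquette with eight abstract letters `A₁…A₄`, `U₁…U₄` and its own
lattice form over `B8CurlGradHolonomy.plaqHol`/`covCurl` (a different lattice carrier: two fixed directions `sμ sν`) — used BY NAME,
instantiated here on the lineage's carrier `plaqU`/`prodCfg`/`covD`/`curl` over `T : ι → S ≃ S`; `B9Eq335Plaquette` (b09) = (3.35) ⟹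
B7 (52) for `U′ = 1` with gauge invariance (pointer, see ABSOLUTE RULE); `B9Eq39Adjoint.wil_plaqU_prodCfg` (this lineage) = the TRACED
word (3.1) (its untraced factorisation was a private `have`; §1 makes it public); `B9Eq369Small` = (3.69) from `‖U(∂p) − 1‖ ≤ ε`
(consumed here); `B8FromB9` (r1) and `B10Eq61PerSite`/`B10Eq61Leaves` (b10) QUOTE (3.69) as a hypothesis.  Nothing in the tree bounds
`(U′U)(∂p) − 1` for `U′ ≠ 1` on the lattice carrier or derives (3.69) for `Δ′(U′U)`.

NOT PROVED HERE, NOT CLAIMED: the domain geometry of (3.35)/(3.37) (`Ω_j`, the cubes `□`, «O(1)M is a size of □», `b ∈ Ω_j` ⟹ the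
plaquettes of `st(b)` lie where (3.37) holds at scale `j`) — the hypotheses are stated PER PLAQUETTE through `b` with the scale-`j`
constants as binders, and the transport-size bound `η‖A′(b)‖ ≤ s` is a separate GLOBAL binder (B9: (3.37) on `Ω₀` gives `s = α₁`;
outside `Ω₀` the print imposes nothing and neither can we — a reader instantiating on a finite volume inside `Ω₀` has it); the step
(3.35) ⟹ `‖U(∂p) − 1‖ ≤ C₀ξ²` for the `G`-valued background (b09, see above); the sentence on `Δ′(U′U) − Δ′(U)` («additional factor
α₁» — «not essential in the sequal [sic]»); the p. 396/397 statement «if U′U satisfies (3.37), (3.38), then it satisfies also (3.35),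
(3.36) with α₀ replaced by O(1)(α₀ + α₁)» («We will prove in another paper … we will not use this fact here» — a gauge-fixing
statement, not attempted); (3.38), (3.70) and everything after; any statement in the normalised Hilbert–Schmidt norm of p. 392 (cell
DIVERGENCE D-1: all bounds here are in the abstract `NormedRing` norm, in which `‖U(b)‖ ≤ ρ` is a hypothesis — for `U(N)` in the
operator norm `ρ = 1`); the identification of `(S, T, ι)` with `T_η` and of `Through` with `st(b)` beyond the displayed formula
(DIVERGENCE D-pv27.7, as D-pv27.6).  Records: GAPS C-pv27-71.  NOT summit progress.

REVISION v1.1 (2026-08-19, same seat; DOCFIX D1 of the cross-read adv9-g57, journal l.55379, GAPS C-adv9-103): LOCATOR ONLY — the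
component formula `(D A)_{μν} = D_μA_ν − D_νA_μ` is the UNNUMBERED display after (3.4) on p. 391 ((3.4) is the four-letter plaquette
form); three locator labels corrected (header ×2, `far_sub_near_eq_curl`).  No declaration, statement or proof changed (v1 = p189850,
commit 98d36d7c90b4).
-/

open NormedSpace Complex

namespace Literature.MathematicalPhysics.QuantumFieldTheory.Balaban1983to89.B9Eq369Product

open Literature.MathematicalPhysics.QuantumFieldTheory.Balaban1983to89.Beta.TransportVertices
open Literature.MathematicalPhysics.QuantumFieldTheory.Balaban1983to89.Beta.AdjointTransportJets
open Literature.MathematicalPhysics.QuantumFieldTheory.Balaban1983to89.B9Eq37Insertion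
open Literature.MathematicalPhysics.QuantumFieldTheory.Balaban1983to89.B9Eq39Adjoint
open Literature.MathematicalPhysics.QuantumFieldTheory.Balaban1983to89.B9Eq310Hermitian
open Literature.MathematicalPhysics.QuantumFieldTheory.Balaban1983to89.B9Eq369Small

/-! ## §1  The bond variables of `U′U` and the plaquette word (3.1), untraced -/

section Word

variable {𝔸 : Type*} [NormedRing 𝔸] [NormedAlgebra ℂ 𝔸] [CompleteSpace 𝔸] {S : Type*} {ι : Type*}
variable (T : ι → Equiv.Perm S) (U : ι → S → 𝔸ˣ)

/-- `U′(b) = e^{iηA′(b)}` as an element of the algebra. [folklore] [cite: Balaban1985BackgroundPropagators, p.396 before (3.37)] -/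
theorem val_fluct (η : ℝ) (A : ι → S → 𝔸) (μ : ι) (x : S) :
    (fluct η A μ x : 𝔸) = exp (((I * η : ℂ)) • A μ x) := by
  simp [fluct, holonomy_cons, holonomy_nil]

/-- `U′(b)⁻¹ = e^{−iηA′(b)}`. [folklore] [cite: Balaban1985BackgroundPropagators, p.396 before (3.37); (3.5) p.391] -/
theorem val_inv_fluct (η : ℝ) (A : ι → S → 𝔸) (μ : ι) (x : S) :
    (((fluct η A μ x)⁻¹ : 𝔸ˣ) : 𝔸) = exp (-(((I * η : ℂ)) • A μ x)) := by
  simp [fluct, holonomy_cons, holonomy_nil]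

/-- `(U′U)(b) = e^{iηA′(b)}·U(b)`. [folklore] [cite: Balaban1985BackgroundPropagators, p.396 before (3.37)] -/
theorem val_prodCfg (η : ℝ) (A : ι → S → 𝔸) (μ : ι) (x : S) :
    (prodCfg U η A μ x : 𝔸) = exp (((I * η : ℂ)) • A μ x) * (U μ x : 𝔸) := by
  simp [prodCfg, val_fluct]

/-- `(U′U)(b)⁻¹ = U(b)⁻¹·e^{−iηA′(b)}` (the reversed bond, (3.5)). [folklore]
[cite: Balaban1985BackgroundPropagators, (3.5) p.391; p.396 before (3.37)] -/
theorem val_inv_prodCfg (η : ℝ) (A : ι → S → 𝔸) (μ : ι) (x : S) :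
    (((prodCfg U η A μ x)⁻¹ : 𝔸ˣ) : 𝔸) = (((U μ x)⁻¹ : 𝔸ˣ) : 𝔸) * exp (-(((I * η : ℂ)) • A μ x)) := by
  simp [prodCfg, mul_inv_rev, val_inv_fluct]

/-- `U′ = 1 ⟺ A′ = 0`: the product configuration of the zero fluctuation field is the background itself. [folklore]
[cite: Balaban1985BackgroundPropagators, p.396 before (3.37)] -/
theorem prodCfg_zero (η : ℝ) : prodCfg U η (0 : ι → S → 𝔸) = U := by
  funext μ x
  ext
  simp [val_prodCfg]

omit [CompleteSpace 𝔸] in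
/-- THE PRINT'S `∇^η` VS THE TREE'S `D¹ = covD`: `‖η⁻¹·(D¹_{U,κ}A′_ν)(y)‖ ≤ g ⟺ ‖(D¹_{U,κ}A′_ν)(y)‖ ≤ η·g` for `η > 0` — so (3.37)'s
«|∇^η_U A′| < α₁(L^jη)⁻²» is the hypothesis `‖covD T U κ (A′ ν) y‖ ≤ η·α₁(L^jη)⁻²` used below. [folklore]
[cite: Balaban1985BackgroundPropagators, p.390 (bottom), (3.37) p.396, (3.39) p.397] -/
theorem norm_eta_inv_smul_le_iff {η g : ℝ} (hη : 0 < η) (X : 𝔸) :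
    ‖((η : ℂ)⁻¹) • X‖ ≤ g ↔ ‖X‖ ≤ η * g := by
  rw [norm_smul, norm_inv, Complex.norm_real, Real.norm_eq_abs, abs_of_pos hη, inv_mul_le_iff₀ hη]

/-- **(3.1) UNTRACED, IN LATTICE VOCABULARY.**  The plaquette variable of the product configuration `U′U` at `p = p_{κν}(y)` is
`(U′U)(∂p) = e^{b₁}·e^{R(U_κ(y))b₂}·U(∂p)·e^{−R(U_ν(y))b₃}·e^{−b₄}` with the four fluctuation letters `b₁ = iηA′_κ(y)`,
`b₂ = iηA′_ν(y+e_κ)`, `b₃ = iηA′_κ(y+e_ν)`, `b₄ = iηA′_ν(y)` — the two far letters transported to the base point by `R(U₀(x,y))`,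
`R(U₀(x,w))` as in «(∂₀U′)((p)_z) = R(U₀(x,w))U′(z,w)U′(w,x)U′(x,y)R(U₀(x,y))U′(y,z)», the background plaquette in the middle
(`B12Membership314.plaquette_mul_background` BY NAME; the lineage's `B9Eq39Adjoint.wil_plaqU_prodCfg` is the traced form).
[folklore] [cite: Balaban1985BackgroundPropagators, (3.1) p.390] -/
theorem plaqU_prodCfg_val (η : ℝ) (A : ι → S → 𝔸) (κ ν : ι) (y : S) :
    (plaqU T (prodCfg U η A) κ ν y : 𝔸)
      = exp (((I * η : ℂ)) • A κ y) * exp (R (U κ y) (((I * η : ℂ)) • A ν (T κ y))) * (plaqU T U κ ν y : 𝔸)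
        * exp (-(R (U ν y) (((I * η : ℂ)) • A κ (T ν y)))) * exp (-(((I * η : ℂ)) • A ν y)) := by
  have h : (plaqU T (prodCfg U η A) κ ν y : 𝔸)
      = (exp (((I * η : ℂ)) • A κ y) * U κ y) * (exp (((I * η : ℂ)) • A ν (T κ y)) * U ν (T κ y))
        * ((((U κ (T ν y))⁻¹ : 𝔸ˣ) : 𝔸) * exp (-(((I * η : ℂ)) • A κ (T ν y))))
        * ((((U ν y)⁻¹ : 𝔸ˣ) : 𝔸) * exp (-(((I * η : ℂ)) • A ν y))) := by
    simp only [plaqU, Units.val_mul, val_prodCfg, val_inv_prodCfg]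
  rw [h, B12Membership314.plaquette_mul_background]
  simp only [R, plaqU, Units.val_mul]

/-- **THE REVERSED CONTOUR**: `(U′U)(∂p)⁻¹ = e^{b₄}·e^{R(U_ν(y))b₃}·U(∂p)⁻¹·e^{−R(U_κ(y))b₂}·e^{−b₁}`. [folklore]
[cite: Balaban1985BackgroundPropagators, (3.1) p.390, (3.5) p.391] -/
theorem plaqU_prodCfg_inv_val (η : ℝ) (A : ι → S → 𝔸) (κ ν : ι) (y : S) :
    (((plaqU T (prodCfg U η A) κ ν y)⁻¹ : 𝔸ˣ) : 𝔸)
      = exp (((I * η : ℂ)) • A ν y) * exp (R (U ν y) (((I * η : ℂ)) • A κ (T ν y)))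
        * (((plaqU T U κ ν y)⁻¹ : 𝔸ˣ) : 𝔸)
        * exp (-(R (U κ y) (((I * η : ℂ)) • A ν (T κ y)))) * exp (-(((I * η : ℂ)) • A κ y)) := by
  have h : (((plaqU T (prodCfg U η A) κ ν y)⁻¹ : 𝔸ˣ) : 𝔸)
      = (exp (((I * η : ℂ)) • A ν y) * U ν y) * (exp (((I * η : ℂ)) • A κ (T ν y)) * U κ (T ν y))
        * ((((U ν (T κ y))⁻¹ : 𝔸ˣ) : 𝔸) * exp (-(((I * η : ℂ)) • A ν (T κ y))))
        * ((((U κ y)⁻¹ : 𝔸ˣ) : 𝔸) * exp (-(((I * η : ℂ)) • A κ y))) := by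
    rw [plaqU_inv_val, val_prodCfg, val_prodCfg, val_inv_prodCfg, val_inv_prodCfg]
  rw [h, B12Membership314.plaquette_mul_background, plaqU_inv_val]
  simp only [R]

/-! ## §2  The dictionary (3.2)/(3.6): transported far letters = near letters + `η`·covariant derivative -/

omit [NormedAlgebra ℂ 𝔸] [CompleteSpace 𝔸] in
/-- `R(U_κ(y))A′_ν(y+e_κ) = A′_ν(y) + (D¹_{U,κ}A′_ν)(y)` — the print's `(D^η_{U₀}A)(b) = η⁻¹(R(U₀(b))A(b₊) − A(b₋))` read as
`R(U₀(b))A(b₊) = A(b₋) + η(D^η_{U₀}A)(b)` (`B9Eq39Adjoint.covD` is `η·D^η`). [folklore]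
[cite: Balaban1985BackgroundPropagators, p.390 (bottom), (3.2) p.390] -/
theorem R_far_eq (A : ι → S → 𝔸) (κ ν : ι) (y : S) :
    R (U κ y) (A ν (T κ y)) = A ν y + covD T U κ (A ν) y := by
  rw [covD, add_sub_cancel]

omit [NormedAlgebra ℂ 𝔸] [CompleteSpace 𝔸] in
/-- The first-order term of the plaquette word is the covariant curl: `(R(U_κ(y))A′_ν(y+e_κ) − A′_ν(y)) − (R(U_ν(y))A′_κ(y+e_ν) − A′_κ(y))
= (D¹_U A′)(p_{κν}(y))` (`B9Eq39Adjoint.curl`; «(D^η_{U₀}A)(p_{μν}(x)) = (D^η_{U₀}A)_{μν}(x) = (D^η_{U₀,μ}A_ν)(x) − (D^η_{U₀,ν}A_μ)(x)»,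
the unnumbered display after (3.4), times `η`). [folklore] [cite: Balaban1985BackgroundPropagators, display after (3.4) p.391] -/
theorem far_sub_near_eq_curl (A : ι → S → 𝔸) (κ ν : ι) (y : S) :
    (R (U κ y) (A ν (T κ y)) - A ν y) - (R (U ν y) (A κ (T ν y)) - A κ y) = curl T U A κ ν y := rfl

omit [NormedAlgebra ℂ 𝔸] [CompleteSpace 𝔸] in
/-- SIZE OF A TRANSPORTED FAR LETTER WITHOUT ANY HYPOTHESIS ON `U`: `‖R(U_κ(y))A′_ν(y+e_κ)‖ ≤ ‖A′_ν(y)‖ + ‖(D¹_{U,κ}A′_ν)(y)‖`.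
[folklore] [cite: Balaban1985BackgroundPropagators, (3.37) p.396, (3.39) p.397] -/
theorem norm_R_far_le (A : ι → S → 𝔸) (κ ν : ι) (y : S) :
    ‖R (U κ y) (A ν (T κ y))‖ ≤ ‖A ν y‖ + ‖covD T U κ (A ν) y‖ := by
  rw [R_far_eq]; exact norm_add_le _ _

end Word

/-! ## §3  «|(U′U)(∂p) − 1| ≤ O(1)(Mα₀ + α₁)ξ²» from (3.35), (3.37) -/

section Plaquette

variable {𝔸 : Type*} [NormedRing 𝔸] [NormedAlgebra ℂ 𝔸] [CompleteSpace 𝔸] {S : Type*} {ι : Type*}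
variable (T : ι → Equiv.Perm S) (U : ι → S → 𝔸ˣ)

omit [NormedAlgebra ℂ 𝔸] [CompleteSpace 𝔸] in
/-- THE LETTER SIZE OF A PLAQUETTE: `S(p) = ‖A′_κ(y)‖ + ‖R(U_κ(y))A′_ν(y+e_κ)‖ + ‖R(U_ν(y))A′_κ(y+e_ν)‖ + ‖A′_ν(y)‖` (the four letters of
`(∂₀U′)((p)_z)` without the factor `iη`). [folklore] [cite: Balaban1985BackgroundPropagators, (3.1) p.390, (3.2) p.390] -/
def letterSize (A : ι → S → 𝔸) (κ ν : ι) (y : S) : ℝ :=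
  ‖A κ y‖ + ‖R (U κ y) (A ν (T κ y))‖ + ‖R (U ν y) (A κ (T ν y))‖ + ‖A ν y‖

omit [NormedAlgebra ℂ 𝔸] [CompleteSpace 𝔸] in
/-- `0 ≤ S(p)`. [folklore] -/
theorem letterSize_nonneg (A : ι → S → 𝔸) (κ ν : ι) (y : S) : 0 ≤ letterSize T U A κ ν y := by
  unfold letterSize; positivity

/-- **THE PRODUCT PLAQUETTE, GENERAL FORM** (any complete normed ℂ-algebra, arbitrary background units, `η ≥ 0`):
`‖(U′U)(∂p) − 1‖ ≤ η‖(D¹_U A′)(p)‖ + ½S(p)²η²e^{ηS(p)} + e^{ηS(p)}‖U(∂p) − 1‖` — first order = `η²·(D^η_U A′)(p)`, second order =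
B12 (3.43)'s `elem343` for the transported letters, plus the dressed background deviation (`B12Membership314.norm_plaquette_expMul_sub_one_le`
BY NAME, composed with §1). [folklore] [cite: Balaban1985BackgroundPropagators, p.404 below (3.69); (3.6) p.391] -/
theorem norm_plaqU_prodCfg_sub_one_le {η : ℝ} (hη : 0 ≤ η) (A : ι → S → 𝔸) (κ ν : ι) (y : S) :
    ‖(plaqU T (prodCfg U η A) κ ν y : 𝔸) - 1‖
      ≤ η * ‖curl T U A κ ν y‖
        + 1 / 2 * letterSize T U A κ ν y ^ 2 * η ^ 2 * Real.exp (η * letterSize T U A κ ν y)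
        + Real.exp (η * letterSize T U A κ ν y) * ‖(plaqU T U κ ν y : 𝔸) - 1‖ := by
  have h : (plaqU T (prodCfg U η A) κ ν y : 𝔸)
      = (exp ((I * η) • A κ y) * U κ y) * (exp ((I * η) • A ν (T κ y)) * U ν (T κ y))
        * ((((U κ (T ν y))⁻¹ : 𝔸ˣ) : 𝔸) * exp (-((I * η) • A κ (T ν y))))
        * ((((U ν y)⁻¹ : 𝔸ˣ) : 𝔸) * exp (-((I * η) • A ν y))) := by
    simp only [plaqU, Units.val_mul, val_prodCfg, val_inv_prodCfg]
  have hP : (plaqU T U κ ν y : 𝔸)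
      = (U κ y : 𝔸) * (U ν (T κ y) : 𝔸) * (((U κ (T ν y))⁻¹ : 𝔸ˣ) : 𝔸) * (((U ν y)⁻¹ : 𝔸ˣ) : 𝔸) := by
    simp only [plaqU, Units.val_mul]
  have e := B12Membership314.norm_plaquette_expMul_sub_one_le hη (A κ y) (A ν (T κ y)) (A κ (T ν y)) (A ν y)
    (U κ y) (U ν (T κ y)) (U κ (T ν y)) (U ν y)
  rw [← h, ← hP] at e
  have hc : ((U κ y : 𝔸) * A ν (T κ y) * (((U κ y)⁻¹ : 𝔸ˣ) : 𝔸) - A ν y)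
      - ((U ν y : 𝔸) * A κ (T ν y) * (((U ν y)⁻¹ : 𝔸ˣ) : 𝔸) - A κ y) = curl T U A κ ν y := rfl
  have hS : ‖A κ y‖ + ‖(U κ y : 𝔸) * A ν (T κ y) * (((U κ y)⁻¹ : 𝔸ˣ) : 𝔸)‖
      + ‖(U ν y : 𝔸) * A κ (T ν y) * (((U ν y)⁻¹ : 𝔸ˣ) : 𝔸)‖ + ‖A ν y‖ = letterSize T U A κ ν y := rfl
  rw [hc, hS] at e
  exact e

/-- **THE PRODUCT PLAQUETTE UNDER (3.37)-TYPE BOUNDS AT `p`** (explicit letters): if `‖A′_κ(y)‖, ‖A′_ν(y)‖ ≤ a₁`, the two covariant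
derivatives at `p` satisfy `‖(D¹_{U,κ}A′_ν)(y)‖, ‖(D¹_{U,ν}A′_κ)(y)‖ ≤ g` (`g = η·|∇^η_U A′|`-bound) and `‖U(∂p) − 1‖ ≤ ε₀`, then
`‖(U′U)(∂p) − 1‖ ≤ 2ηg + ½(4a₁ + 2g)²η²e^{η(4a₁+2g)} + e^{η(4a₁+2g)}ε₀`. [folklore]
[cite: Balaban1985BackgroundPropagators, p.404 below (3.69); (3.37) p.396] -/
theorem norm_plaqU_prodCfg_sub_one_le_of_bounds {η a₁ g ε₀ : ℝ} (hη : 0 ≤ η) {A : ι → S → 𝔸} {κ ν : ι} {y : S}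
    (h₁ : ‖A κ y‖ ≤ a₁) (h₄ : ‖A ν y‖ ≤ a₁) (hDκ : ‖covD T U κ (A ν) y‖ ≤ g) (hDν : ‖covD T U ν (A κ) y‖ ≤ g)
    (hP : ‖(plaqU T U κ ν y : 𝔸) - 1‖ ≤ ε₀) :
    ‖(plaqU T (prodCfg U η A) κ ν y : 𝔸) - 1‖
      ≤ 2 * η * g + 1 / 2 * (4 * a₁ + 2 * g) ^ 2 * η ^ 2 * Real.exp (η * (4 * a₁ + 2 * g))
        + Real.exp (η * (4 * a₁ + 2 * g)) * ε₀ := by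
  have hS : letterSize T U A κ ν y ≤ 4 * a₁ + 2 * g := by
    unfold letterSize
    have e₂ := (norm_R_far_le T U A κ ν y).trans (add_le_add h₄ hDκ)
    have e₃ := (norm_R_far_le T U A ν κ y).trans (add_le_add h₁ hDν)
    linarith
  have hS0 := letterSize_nonneg T U A κ ν y
  have hcurl : ‖curl T U A κ ν y‖ ≤ 2 * g := by
    unfold curl
    exact (norm_sub_le _ _).trans (by linarith)
  have hexp : Real.exp (η * letterSize T U A κ ν y) ≤ Real.exp (η * (4 * a₁ + 2 * g)) :=
    Real.exp_le_exp.mpr (mul_le_mul_of_nonneg_left hS hη)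
  have hε₀ : 0 ≤ ε₀ := (norm_nonneg _).trans hP
  refine (norm_plaqU_prodCfg_sub_one_le T U hη A κ ν y).trans ?_
  have t1 : η * ‖curl T U A κ ν y‖ ≤ 2 * η * g := by nlinarith [norm_nonneg (curl T U A κ ν y)]
  have t2 : 1 / 2 * letterSize T U A κ ν y ^ 2 * η ^ 2 * Real.exp (η * letterSize T U A κ ν y)
      ≤ 1 / 2 * (4 * a₁ + 2 * g) ^ 2 * η ^ 2 * Real.exp (η * (4 * a₁ + 2 * g)) := by
    gcongr
  have t3 : Real.exp (η * letterSize T U A κ ν y) * ‖(plaqU T U κ ν y : 𝔸) - 1‖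
      ≤ Real.exp (η * (4 * a₁ + 2 * g)) * ε₀ :=
    mul_le_mul hexp hP (norm_nonneg _) (Real.exp_pos _).le
  linarith

/-- THE REAL-ARITHMETIC BUDGET: with `ξ = η/ℓ ∈ (0,1]`, letters `a₁ = α₁ℓ⁻¹`, `g = ηα₁ℓ⁻²` and `ε₀ = C₀ξ²` the bound of
`norm_plaqU_prodCfg_sub_one_le_of_bounds` is `≤ e^{6α₁ξ}(C₀ + 2α₁ + 18α₁²)ξ²` (`2ηg = 2α₁ξ²`, `η(4a₁ + 2g) = α₁ξ(4 + 2ξ) ≤ 6α₁ξ`).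
[folklore] [cite: Balaban1985BackgroundPropagators, p.404 below (3.69)] -/
theorem budget_xi {η ℓ α₁ C₀ : ℝ} (hη : 0 < η) (hηℓ : η ≤ ℓ) (hα : 0 ≤ α₁) (hC : 0 ≤ C₀ * (η / ℓ) ^ 2) :
    2 * η * (η * (α₁ * (ℓ ^ 2)⁻¹))
        + 1 / 2 * (4 * (α₁ * ℓ⁻¹) + 2 * (η * (α₁ * (ℓ ^ 2)⁻¹))) ^ 2 * η ^ 2
            * Real.exp (η * (4 * (α₁ * ℓ⁻¹) + 2 * (η * (α₁ * (ℓ ^ 2)⁻¹))))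
        + Real.exp (η * (4 * (α₁ * ℓ⁻¹) + 2 * (η * (α₁ * (ℓ ^ 2)⁻¹)))) * (C₀ * (η / ℓ) ^ 2)
      ≤ Real.exp (6 * α₁ * (η / ℓ)) * (C₀ + 2 * α₁ + 18 * α₁ ^ 2) * (η / ℓ) ^ 2 := by
  have hℓ : 0 < ℓ := lt_of_lt_of_le hη hηℓ
  set ξ := η / ℓ with hξ
  have hξ0 : 0 < ξ := div_pos hη hℓ
  have hξ1 : ξ ≤ 1 := (div_le_one hℓ).mpr hηℓ
  have e1 : 2 * η * (η * (α₁ * (ℓ ^ 2)⁻¹)) = 2 * α₁ * ξ ^ 2 := by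
    rw [hξ]; field_simp
  have eM : η * (4 * (α₁ * ℓ⁻¹) + 2 * (η * (α₁ * (ℓ ^ 2)⁻¹))) = α₁ * ξ * (4 + 2 * ξ) := by
    rw [hξ]; field_simp
  have e2 : 1 / 2 * (4 * (α₁ * ℓ⁻¹) + 2 * (η * (α₁ * (ℓ ^ 2)⁻¹))) ^ 2 * η ^ 2
      = 1 / 2 * (α₁ * ξ * (4 + 2 * ξ)) ^ 2 := by
    rw [← eM]; ring
  have hαξ : 0 ≤ α₁ * ξ := mul_nonneg hα hξ0.le
  have hM6 : α₁ * ξ * (4 + 2 * ξ) ≤ 6 * α₁ * ξ := by nlinarith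
  have hM0 : 0 ≤ α₁ * ξ * (4 + 2 * ξ) := by positivity
  have hE : Real.exp (α₁ * ξ * (4 + 2 * ξ)) ≤ Real.exp (6 * α₁ * ξ) := Real.exp_le_exp.mpr hM6
  have hE1 : 1 ≤ Real.exp (6 * α₁ * ξ) := Real.one_le_exp (by positivity)
  have hsq : (α₁ * ξ * (4 + 2 * ξ)) ^ 2 ≤ (6 * α₁ * ξ) ^ 2 := pow_le_pow_left₀ hM0 hM6 2
  rw [e1, e2, eM]
  have t2 : 1 / 2 * (α₁ * ξ * (4 + 2 * ξ)) ^ 2 * Real.exp (α₁ * ξ * (4 + 2 * ξ))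
      ≤ 18 * α₁ ^ 2 * ξ ^ 2 * Real.exp (6 * α₁ * ξ) :=
    mul_le_mul (by nlinarith) hE (Real.exp_pos _).le (by positivity)
  have t3 : Real.exp (α₁ * ξ * (4 + 2 * ξ)) * (C₀ * ξ ^ 2) ≤ Real.exp (6 * α₁ * ξ) * (C₀ * ξ ^ 2) :=
    mul_le_mul_of_nonneg_right hE hC
  have t1 : 2 * α₁ * ξ ^ 2 ≤ Real.exp (6 * α₁ * ξ) * (2 * α₁ * ξ ^ 2) :=
    le_mul_of_one_le_left (by positivity) hE1
  nlinarith [t1, t2, t3]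

/-- **«|(U′U)(∂p) − 1| ≤ O(1)(Mα₀ + α₁)ξ²» WITH `O(1)` EXPLICIT, scale `ℓ`.**  If at the plaquette `p = p_{κν}(y)` the fluctuation
field satisfies the (3.37)-type bounds `‖A′_κ(y)‖, ‖A′_ν(y)‖ ≤ α₁ℓ⁻¹`, `‖(D¹_{U,κ}A′_ν)(y)‖, ‖(D¹_{U,ν}A′_κ)(y)‖ ≤ η·α₁ℓ⁻²`
(`D¹ = η·∇^η_U`: «|∇^η_U A′| < α₁(L^jη)⁻²», `ℓ = L^jη`), `0 < η ≤ ℓ`, and the background plaquette satisfies the OUTPUT of (3.35)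
`‖U(∂p) − 1‖ ≤ C₀(η/ℓ)²` (`C₀ = O(1)Mα₀`-constant; for the derivation from (3.35) see `B9Eq335Plaquette`, U′ = 1), then
`‖(U′U)(∂p) − 1‖ ≤ e^{6α₁ξ}(C₀ + 2α₁ + 18α₁²)ξ²`, `ξ = η/ℓ` — no norm hypothesis on the background bond variables. [folklore]
[cite: Balaban1985BackgroundPropagators, p.404 below (3.69); (3.35) p.396, (3.37) p.396] -/
theorem norm_plaqU_prodCfg_sub_one_le_xi {η ℓ α₁ C₀ : ℝ} (hη : 0 < η) (hηℓ : η ≤ ℓ) {A : ι → S → 𝔸} {κ ν : ι} {y : S}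
    (h₁ : ‖A κ y‖ ≤ α₁ * ℓ⁻¹) (h₄ : ‖A ν y‖ ≤ α₁ * ℓ⁻¹)
    (hDκ : ‖covD T U κ (A ν) y‖ ≤ η * (α₁ * (ℓ ^ 2)⁻¹)) (hDν : ‖covD T U ν (A κ) y‖ ≤ η * (α₁ * (ℓ ^ 2)⁻¹))
    (hP : ‖(plaqU T U κ ν y : 𝔸) - 1‖ ≤ C₀ * (η / ℓ) ^ 2) :
    ‖(plaqU T (prodCfg U η A) κ ν y : 𝔸) - 1‖
      ≤ Real.exp (6 * α₁ * (η / ℓ)) * (C₀ + 2 * α₁ + 18 * α₁ ^ 2) * (η / ℓ) ^ 2 := by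
  have hℓ : 0 < ℓ := lt_of_lt_of_le hη hηℓ
  have hα : 0 ≤ α₁ := by
    have := (norm_nonneg _).trans h₁
    rwa [mul_nonneg_iff_of_pos_right (inv_pos.mpr hℓ)] at this
  exact (norm_plaqU_prodCfg_sub_one_le_of_bounds T U hη.le h₁ h₄ hDκ hDν hP).trans
    (budget_xi hη hηℓ hα ((norm_nonneg _).trans hP))

/-- `η/(L^jη) = L^{−j}`: «ξ = L^{−j}». [folklore] [cite: Balaban1985BackgroundPropagators, p.404 below (3.69)] -/
theorem eta_div_scale (L η : ℝ) (hη : η ≠ 0) (j : ℕ) : η / (L ^ j * η) = (L ^ j)⁻¹ := by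
  rw [mul_comm, ← div_div, div_self hη, one_div]

/-- **«|(U′U)(∂p) − 1| ≤ O(1)(Mα₀ + α₁)ξ², ξ = L^{−j}» — THE PRINTED LETTERS.**  With `ℓ = L^jη` (`L ≥ 1`, `η > 0`): (3.37) at `p`
(`‖A′(b′)‖ ≤ α₁(L^jη)⁻¹` on the two base bonds, `‖(D¹_U A′)‖ ≤ η·α₁(L^jη)⁻²` for the two covariant derivatives at `y`) and the
(3.35)-output `‖U(∂p) − 1‖ ≤ C₀·L^{−2j}` give `‖(U′U)(∂p) − 1‖ ≤ e^{6α₁}(C₀ + 2α₁ + 18α₁²)·L^{−2j}`. [folklore]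
[cite: Balaban1985BackgroundPropagators, p.404 below (3.69); (3.35) p.396, (3.37) p.396] -/
theorem norm_plaqU_prodCfg_sub_one_le_printed {η L α₁ C₀ : ℝ} {j : ℕ} (hη : 0 < η) (hL : 1 ≤ L) {A : ι → S → 𝔸}
    {κ ν : ι} {y : S} (h₁ : ‖A κ y‖ ≤ α₁ * (L ^ j * η)⁻¹) (h₄ : ‖A ν y‖ ≤ α₁ * (L ^ j * η)⁻¹)
    (hDκ : ‖covD T U κ (A ν) y‖ ≤ η * (α₁ * ((L ^ j * η) ^ 2)⁻¹))
    (hDν : ‖covD T U ν (A κ) y‖ ≤ η * (α₁ * ((L ^ j * η) ^ 2)⁻¹))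
    (hP : ‖(plaqU T U κ ν y : 𝔸) - 1‖ ≤ C₀ * ((L ^ j)⁻¹) ^ 2) :
    ‖(plaqU T (prodCfg U η A) κ ν y : 𝔸) - 1‖
      ≤ Real.exp (6 * α₁) * (C₀ + 2 * α₁ + 18 * α₁ ^ 2) * ((L ^ j)⁻¹) ^ 2 := by
  have hLj : 1 ≤ L ^ j := one_le_pow₀ hL
  have hηℓ : η ≤ L ^ j * η := le_mul_of_one_le_left hη.le hLj
  have hξ := eta_div_scale L η hη.ne' j
  have hα : 0 ≤ α₁ := by
    have := (norm_nonneg _).trans h₁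
    rwa [mul_nonneg_iff_of_pos_right (inv_pos.mpr (mul_pos (by positivity) hη))] at this
  have hC : 0 ≤ C₀ + 2 * α₁ + 18 * α₁ ^ 2 := by
    have h0 : 0 ≤ C₀ * ((L ^ j)⁻¹) ^ 2 := (norm_nonneg _).trans hP
    have : 0 ≤ C₀ := by
      rwa [mul_nonneg_iff_of_pos_right (by positivity)] at h0
    positivity
  rw [← hξ] at hP ⊢
  refine (norm_plaqU_prodCfg_sub_one_le_xi T U hη hηℓ h₁ h₄ hDκ hDν hP).trans ?_
  have hξ1 : η / (L ^ j * η) ≤ 1 := by rw [hξ]; exact inv_le_one_of_one_le₀ hLj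
  have hE : Real.exp (6 * α₁ * (η / (L ^ j * η))) ≤ Real.exp (6 * α₁) :=
    Real.exp_le_exp.mpr (by nlinarith)
  gcongr

/-- THE LINEAR SHAPE `O(1)(Mα₀ + α₁)`: for `0 ≤ α₁ ≤ 1`, `0 ≤ C₀`: `e^{6α₁}(C₀ + 2α₁ + 18α₁²) ≤ 20e⁶·(C₀ + α₁)` — the print's
`O(1)(Mα₀ + α₁)` with `C₀ = O(1)Mα₀` and `O(1) = 20e⁶`. [folklore] [cite: Balaban1985BackgroundPropagators, p.404 below (3.69)] -/
theorem const_linear_shape {α₁ C₀ : ℝ} (hα : 0 ≤ α₁) (hα1 : α₁ ≤ 1) (hC : 0 ≤ C₀) :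
    Real.exp (6 * α₁) * (C₀ + 2 * α₁ + 18 * α₁ ^ 2) ≤ 20 * Real.exp 6 * (C₀ + α₁) := by
  have hE : Real.exp (6 * α₁) ≤ Real.exp 6 := Real.exp_le_exp.mpr (by linarith)
  have hq : C₀ + 2 * α₁ + 18 * α₁ ^ 2 ≤ 20 * (C₀ + α₁) := by nlinarith
  calc Real.exp (6 * α₁) * (C₀ + 2 * α₁ + 18 * α₁ ^ 2) ≤ Real.exp 6 * (20 * (C₀ + α₁)) :=
        mul_le_mul hE hq (by positivity) (Real.exp_pos _).le
    _ = 20 * Real.exp 6 * (C₀ + α₁) := by ring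

end Plaquette

/-! ## §4  The reversed contour and the display «|Re(U′U)(∂p) − 1|, |Im(U′U)(∂p)| ≤ O(1)(Mα₀ + α₁)ξ²» -/

section ReIm

variable {𝔸 : Type*} [NormedRing 𝔸] [NormedAlgebra ℂ 𝔸] [CompleteSpace 𝔸] {S : Type*} {ι : Type*}
variable (T : ι → Equiv.Perm S) (U : ι → S → 𝔸ˣ)

/-- `‖(U′U)(∂p)⁻¹‖ ≤ e^{ηS(p)}‖U(∂p)⁻¹‖` (the reversed word dressed: `B12Membership314.norm_dressed_le` BY NAME). [folklore]
[cite: Balaban1985BackgroundPropagators, (3.5) p.391; p.404 below (3.69)] -/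
theorem norm_plaqU_prodCfg_inv_le {η : ℝ} (hη : 0 ≤ η) (A : ι → S → 𝔸) (κ ν : ι) (y : S) :
    ‖(((plaqU T (prodCfg U η A) κ ν y)⁻¹ : 𝔸ˣ) : 𝔸)‖
      ≤ Real.exp (η * letterSize T U A κ ν y) * ‖(((plaqU T U κ ν y)⁻¹ : 𝔸ˣ) : 𝔸)‖ := by
  rw [plaqU_prodCfg_inv_val]
  refine (B12Membership314.norm_dressed_le _ _ _ _ _).trans (le_of_eq ?_)
  rw [R_smul, R_smul, B12Membership314.norm_I_mul_smul hη, B12Membership314.norm_I_mul_smul hη,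
    B12Membership314.norm_I_mul_smul hη, B12Membership314.norm_I_mul_smul hη, letterSize]
  ring_nf

/-- **|Re(U′U)(∂p) − 1| ≤ ½(1 + e^{ηS(p)}r₀)·|(U′U)(∂p) − 1|** for `‖U(∂p)⁻¹‖ ≤ r₀` (`B9Eq369Small.norm_reC_sub_one_le` BY NAME).
[folklore] [cite: Balaban1985BackgroundPropagators, p.404 below (3.69); Re after (3.7) p.391] -/
theorem norm_reC_prodCfg_sub_one_le {η r₀ : ℝ} (hη : 0 ≤ η) (A : ι → S → 𝔸) {κ ν : ι} {y : S}
    (hr : ‖(((plaqU T U κ ν y)⁻¹ : 𝔸ˣ) : 𝔸)‖ ≤ r₀) :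
    ‖reC (plaqU T (prodCfg U η A) κ ν y) - 1‖
      ≤ (1 + Real.exp (η * letterSize T U A κ ν y) * r₀) / 2 * ‖(plaqU T (prodCfg U η A) κ ν y : 𝔸) - 1‖ :=
  norm_reC_sub_one_le
    ((norm_plaqU_prodCfg_inv_le T U hη A κ ν y).trans (mul_le_mul_of_nonneg_left hr (Real.exp_pos _).le))

/-- **|Im(U′U)(∂p)| ≤ ½(1 + e^{ηS(p)}r₀)·|(U′U)(∂p) − 1|** for `‖U(∂p)⁻¹‖ ≤ r₀` (`B9Eq369Small.norm_imC_le` BY NAME). [folklore]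
[cite: Balaban1985BackgroundPropagators, p.404 below (3.69); Im after (3.7) p.391] -/
theorem norm_imC_prodCfg_le {η r₀ : ℝ} (hη : 0 ≤ η) (A : ι → S → 𝔸) {κ ν : ι} {y : S}
    (hr : ‖(((plaqU T U κ ν y)⁻¹ : 𝔸ˣ) : 𝔸)‖ ≤ r₀) :
    ‖imC (plaqU T (prodCfg U η A) κ ν y)‖
      ≤ (1 + Real.exp (η * letterSize T U A κ ν y) * r₀) / 2 * ‖(plaqU T (prodCfg U η A) κ ν y : 𝔸) - 1‖ :=
  norm_imC_le
    ((norm_plaqU_prodCfg_inv_le T U hη A κ ν y).trans (mul_le_mul_of_nonneg_left hr (Real.exp_pos _).le))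

omit [NormedAlgebra ℂ 𝔸] [CompleteSpace 𝔸] in
/-- `ηS(p) ≤ 6α₁` under the (3.37)-type letters at scale `ℓ = L^jη ≥ η`. [folklore]
[cite: Balaban1985BackgroundPropagators, (3.37) p.396] -/
theorem eta_mul_letterSize_le {η L α₁ : ℝ} {j : ℕ} (hη : 0 < η) (hL : 1 ≤ L) {A : ι → S → 𝔸} {κ ν : ι} {y : S}
    (h₁ : ‖A κ y‖ ≤ α₁ * (L ^ j * η)⁻¹) (h₄ : ‖A ν y‖ ≤ α₁ * (L ^ j * η)⁻¹)
    (hDκ : ‖covD T U κ (A ν) y‖ ≤ η * (α₁ * ((L ^ j * η) ^ 2)⁻¹))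
    (hDν : ‖covD T U ν (A κ) y‖ ≤ η * (α₁ * ((L ^ j * η) ^ 2)⁻¹)) :
    η * letterSize T U A κ ν y ≤ 6 * α₁ := by
  have hLj : 1 ≤ L ^ j := one_le_pow₀ hL
  have hℓ : 0 < L ^ j * η := mul_pos (by positivity) hη
  have hα : 0 ≤ α₁ := by
    have := (norm_nonneg _).trans h₁
    rwa [mul_nonneg_iff_of_pos_right (inv_pos.mpr hℓ)] at this
  have hS : letterSize T U A κ ν y ≤ 4 * (α₁ * (L ^ j * η)⁻¹) + 2 * (η * (α₁ * ((L ^ j * η) ^ 2)⁻¹)) := by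
    unfold letterSize
    have e₂ := (norm_R_far_le T U A κ ν y).trans (add_le_add h₄ hDκ)
    have e₃ := (norm_R_far_le T U A ν κ y).trans (add_le_add h₁ hDν)
    linarith
  have hξ : η * (L ^ j * η)⁻¹ = (L ^ j)⁻¹ := by rw [← div_eq_mul_inv, eta_div_scale L η hη.ne' j]
  have hξ1 : (L ^ j)⁻¹ ≤ 1 := inv_le_one_of_one_le₀ hLj
  have hξ0 : 0 ≤ (L ^ j)⁻¹ := by positivity
  calc η * letterSize T U A κ ν y ≤ η * (4 * (α₁ * (L ^ j * η)⁻¹) + 2 * (η * (α₁ * ((L ^ j * η) ^ 2)⁻¹))) :=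
        mul_le_mul_of_nonneg_left hS hη.le
    _ = α₁ * (η * (L ^ j * η)⁻¹) * (4 + 2 * (η * (L ^ j * η)⁻¹)) := by
        field_simp
    _ = α₁ * (L ^ j)⁻¹ * (4 + 2 * (L ^ j)⁻¹) := by rw [hξ]
    _ ≤ 6 * α₁ := by nlinarith [mul_nonneg hα hξ0]

/-- **THE DISPLAY BELOW (3.69) FOR THE PRODUCT CONFIGURATION, PRINTED LETTERS.**  Under (3.37) at `p` (scale `L^jη`, `L ≥ 1`, `η > 0`),
the (3.35)-output `‖U(∂p) − 1‖ ≤ C₀L^{−2j}` and `‖U(∂p)⁻¹‖ ≤ r₀` (`r₀ = 1` for `G`-valued `U`):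
`|Re(U′U)(∂p) − 1|, |Im(U′U)(∂p)| ≤ ½(1 + e^{6α₁}r₀)·e^{6α₁}(C₀ + 2α₁ + 18α₁²)·L^{−2j}` — «≤ O(1)(Mα₀ + α₁)ξ², ξ = L^{−j} … the
estimates follow directly from the assumptions (3.35), (3.37)». [folklore]
[cite: Balaban1985BackgroundPropagators, p.404 below (3.69); (3.35) p.396, (3.37) p.396] -/
theorem re_im_prodCfg_le_printed {η L α₁ C₀ r₀ : ℝ} {j : ℕ} (hη : 0 < η) (hL : 1 ≤ L) {A : ι → S → 𝔸}
    {κ ν : ι} {y : S} (h₁ : ‖A κ y‖ ≤ α₁ * (L ^ j * η)⁻¹) (h₄ : ‖A ν y‖ ≤ α₁ * (L ^ j * η)⁻¹)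
    (hDκ : ‖covD T U κ (A ν) y‖ ≤ η * (α₁ * ((L ^ j * η) ^ 2)⁻¹))
    (hDν : ‖covD T U ν (A κ) y‖ ≤ η * (α₁ * ((L ^ j * η) ^ 2)⁻¹))
    (hP : ‖(plaqU T U κ ν y : 𝔸) - 1‖ ≤ C₀ * ((L ^ j)⁻¹) ^ 2) (hr : ‖(((plaqU T U κ ν y)⁻¹ : 𝔸ˣ) : 𝔸)‖ ≤ r₀) :
    ‖reC (plaqU T (prodCfg U η A) κ ν y) - 1‖
        ≤ (1 + Real.exp (6 * α₁) * r₀) / 2 * (Real.exp (6 * α₁) * (C₀ + 2 * α₁ + 18 * α₁ ^ 2) * ((L ^ j)⁻¹) ^ 2) ∧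
      ‖imC (plaqU T (prodCfg U η A) κ ν y)‖
        ≤ (1 + Real.exp (6 * α₁) * r₀) / 2 * (Real.exp (6 * α₁) * (C₀ + 2 * α₁ + 18 * α₁ ^ 2) * ((L ^ j)⁻¹) ^ 2) := by
  have hr0 : 0 ≤ r₀ := (norm_nonneg _).trans hr
  have hW := norm_plaqU_prodCfg_sub_one_le_printed T U hη hL h₁ h₄ hDκ hDν hP
  have hE : Real.exp (η * letterSize T U A κ ν y) ≤ Real.exp (6 * α₁) :=
    Real.exp_le_exp.mpr (eta_mul_letterSize_le T U hη hL h₁ h₄ hDκ hDν)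
  have hfac : (1 + Real.exp (η * letterSize T U A κ ν y) * r₀) / 2 ≤ (1 + Real.exp (6 * α₁) * r₀) / 2 := by
    gcongr
  have h0 : 0 ≤ (1 + Real.exp (η * letterSize T U A κ ν y) * r₀) / 2 := by positivity
  exact ⟨(norm_reC_prodCfg_sub_one_le T U hη.le A hr).trans (mul_le_mul hfac hW (norm_nonneg _) (h0.trans hfac)),
    (norm_imC_prodCfg_le T U hη.le A hr).trans (mul_le_mul hfac hW (norm_nonneg _) (h0.trans hfac))⟩

end ReIm

/-! ## §5  The transport factor of `U′U` and (3.69) for the product configuration -/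

section Eq369

variable {𝔸 : Type*} [NormedRing 𝔸] [NormedAlgebra ℂ 𝔸] [CompleteSpace 𝔸] {S : Type*} {ι : Type*}
variable (T : ι → Equiv.Perm S) (U : ι → S → 𝔸ˣ)

/-- THE BOND VARIABLES OF `U′U` ARE `e^{s}ρ`-BOUNDED: `η‖A′(b)‖ ≤ s` and `‖U(b)‖, ‖U(b)⁻¹‖ ≤ ρ` give `‖(U′U)(b)‖, ‖(U′U)(b)⁻¹‖ ≤ e^{s}ρ`
(`Beta.TransportVertices.norm_exp_mul_le`, `B12Membership314.norm_mul_exp_le` BY NAME; no `‖1‖ = 1`, no unitarity). [folklore]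
[cite: Balaban1985BackgroundPropagators, (3.37) p.396; p.396 before (3.37)] -/
theorem norm_prodCfg_le {η s ρ : ℝ} (hη : 0 ≤ η) {A : ι → S → 𝔸} (hs : ∀ μ x, η * ‖A μ x‖ ≤ s)
    (hUρ : ∀ μ x, ‖(U μ x : 𝔸)‖ ≤ ρ ∧ ‖(((U μ x)⁻¹ : 𝔸ˣ) : 𝔸)‖ ≤ ρ) (μ : ι) (x : S) :
    ‖(prodCfg U η A μ x : 𝔸)‖ ≤ Real.exp s * ρ ∧ ‖(((prodCfg U η A μ x)⁻¹ : 𝔸ˣ) : 𝔸)‖ ≤ Real.exp s * ρ := by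
  have hρ0 : 0 ≤ ρ := (norm_nonneg _).trans (hUρ μ x).1
  have hE : Real.exp ‖((I * η : ℂ)) • A μ x‖ ≤ Real.exp s := by
    rw [B12Membership314.norm_I_mul_smul hη]; exact Real.exp_le_exp.mpr (hs μ x)
  refine ⟨?_, ?_⟩
  · rw [val_prodCfg]
    exact (norm_exp_mul_le ℂ _ _).trans (mul_le_mul hE (hUρ μ x).1 (norm_nonneg _) (Real.exp_pos _).le)
  · rw [val_inv_prodCfg]
    refine (B12Membership314.norm_mul_exp_le _ _).trans ?_
    rw [norm_neg, mul_comm]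
    exact mul_le_mul hE (hUρ μ x).2 (norm_nonneg _) (Real.exp_pos _).le

/-- `1 ≤ e^{s}ρ` for `1 ≤ ρ`, `0 ≤ s`. [folklore] -/
theorem one_le_exp_mul {s ρ : ℝ} (hs : 0 ≤ s) (hρ : 1 ≤ ρ) : 1 ≤ Real.exp s * ρ :=
  one_le_mul_of_one_le_of_one_le (Real.one_le_exp hs) hρ

/-- **(3.69) FOR THE PRODUCT CONFIGURATION `U′U`, PRINTED LETTERS.**  Let the background bond variables satisfy `‖U(b′)^{±1}‖ ≤ ρ`
(`1 ≤ ρ`; `ρ = 1` for `G`-valued `U`) and the fluctuation field the transport-size bound `η‖A′(b′)‖ ≤ s` on all bonds (`s = α₁` from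
(3.37) on `Ω₀`; `0 ≤ s`).  If on every plaquette `p ∈ st(b)` through `b = ⟨x, x+e_μ⟩`: (3.37) at `p` at scale `L^jη` (`L ≥ 1`, `η > 0`),
the (3.35)-output `‖U(∂p) − 1‖ ≤ C₀L^{−2j}`, and `‖A(b′)‖ ≤ a` on the four bonds `b′ ⊂ ∂p`, then
`‖(Δ′(U′U)A)(b)‖ ≤ 14(d − 1)·ρ′⁴·½(1 + ρ′⁴)·e^{6α₁}(C₀ + 2α₁ + 18α₁²)·(L^jη)⁻²·a`, `ρ′ = e^{s}ρ` — «|(Δ′(U′U)A′)(b)| ≤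
O(1)(Mα₀ + α₁)(L^jη)⁻²|A′|, b ∈ Ω_j» with every `O(1)` explicit (`B9Eq369Small.eq369_local_rho` BY NAME applied to `prodCfg`).
[folklore] [cite: Balaban1985BackgroundPropagators, (3.69) p.404; (3.35) p.396, (3.37) p.396] -/
theorem eq369_prodCfg [Fintype ι] [LinearOrder ι] {ρ s η L α₁ C₀ a : ℝ} {j : ℕ} (hρ : 1 ≤ ρ)
    (hUρ : ∀ μ x, ‖(U μ x : 𝔸)‖ ≤ ρ ∧ ‖(((U μ x)⁻¹ : 𝔸ˣ) : 𝔸)‖ ≤ ρ) (hη : 0 < η) (hL : 1 ≤ L) (hs0 : 0 ≤ s)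
    {A' : ι → S → 𝔸} (hs : ∀ μ x, η * ‖A' μ x‖ ≤ s) {A : ι → S → 𝔸} (μ : ι) (x : S)
    (h37 : ∀ κ ν y, Through T μ x κ ν y →
      ‖A' κ y‖ ≤ α₁ * (L ^ j * η)⁻¹ ∧ ‖A' ν y‖ ≤ α₁ * (L ^ j * η)⁻¹ ∧
        ‖covD T U κ (A' ν) y‖ ≤ η * (α₁ * ((L ^ j * η) ^ 2)⁻¹) ∧ ‖covD T U ν (A' κ) y‖ ≤ η * (α₁ * ((L ^ j * η) ^ 2)⁻¹))
    (h35 : ∀ κ ν y, Through T μ x κ ν y → ‖(plaqU T U κ ν y : 𝔸) - 1‖ ≤ C₀ * ((L ^ j)⁻¹) ^ 2)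
    (hA : ∀ κ ν y, Through T μ x κ ν y → ‖A κ y‖ ≤ a ∧ ‖A ν (T κ y)‖ ≤ a ∧ ‖A κ (T ν y)‖ ≤ a ∧ ‖A ν y‖ ≤ a) :
    ‖deltaPrimeOp T (prodCfg U η A') η A μ x‖
      ≤ (14 * ((Fintype.card ι - 1 : ℕ) : ℝ)) * ((Real.exp s * ρ) ^ 4 * ((1 + (Real.exp s * ρ) ^ 4) / 2))
          * (Real.exp (6 * α₁) * (C₀ + 2 * α₁ + 18 * α₁ ^ 2)) * ((L ^ j * η) ^ 2)⁻¹ * a := by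
  have hρ' : 1 ≤ Real.exp s * ρ := one_le_exp_mul hs0 hρ
  have hVρ := norm_prodCfg_le U hη.le hs hUρ
  have hplaq : ∀ κ ν y, Through T μ x κ ν y → ‖(plaqU T (prodCfg U η A') κ ν y : 𝔸) - 1‖
      ≤ Real.exp (6 * α₁) * (C₀ + 2 * α₁ + 18 * α₁ ^ 2) * ((L ^ j)⁻¹) ^ 2 := by
    intro κ ν y h
    obtain ⟨h₁, h₄, hDκ, hDν⟩ := h37 κ ν y h
    exact norm_plaqU_prodCfg_sub_one_le_printed T U hη hL h₁ h₄ hDκ hDν (h35 κ ν y h)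
  refine (eq369_local_rho T (prodCfg U η A') hρ' hVρ μ x hA hplaq).trans (le_of_eq ?_)
  rw [← xi_sq_div_eta_sq]
  ring

/-- **(3.69) FOR `U′U`, GROUP-VALUED BACKGROUND** (`ρ = 1`, `s = α₁`: «U has values in G and U′ = e^{iηA′}», `η|A′| ≤ α₁` from (3.37) on
`Ω₀`): `‖(Δ′(U′U)A)(b)‖ ≤ 14(d − 1)·e^{4α₁}·½(1 + e^{4α₁})·e^{6α₁}(C₀ + 2α₁ + 18α₁²)·(L^jη)⁻²·a`. [folklore]
[cite: Balaban1985BackgroundPropagators, (3.69) p.404; p.396 before (3.37)] -/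
theorem eq369_prodCfg_group [Fintype ι] [LinearOrder ι] {η L α₁ C₀ a : ℝ} {j : ℕ}
    (hU1 : ∀ μ x, ‖(U μ x : 𝔸)‖ ≤ 1 ∧ ‖(((U μ x)⁻¹ : 𝔸ˣ) : 𝔸)‖ ≤ 1) (hη : 0 < η) (hL : 1 ≤ L) (hα : 0 ≤ α₁)
    {A' : ι → S → 𝔸} (hs : ∀ μ x, η * ‖A' μ x‖ ≤ α₁) {A : ι → S → 𝔸} (μ : ι) (x : S)
    (h37 : ∀ κ ν y, Through T μ x κ ν y →
      ‖A' κ y‖ ≤ α₁ * (L ^ j * η)⁻¹ ∧ ‖A' ν y‖ ≤ α₁ * (L ^ j * η)⁻¹ ∧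
        ‖covD T U κ (A' ν) y‖ ≤ η * (α₁ * ((L ^ j * η) ^ 2)⁻¹) ∧ ‖covD T U ν (A' κ) y‖ ≤ η * (α₁ * ((L ^ j * η) ^ 2)⁻¹))
    (h35 : ∀ κ ν y, Through T μ x κ ν y → ‖(plaqU T U κ ν y : 𝔸) - 1‖ ≤ C₀ * ((L ^ j)⁻¹) ^ 2)
    (hA : ∀ κ ν y, Through T μ x κ ν y → ‖A κ y‖ ≤ a ∧ ‖A ν (T κ y)‖ ≤ a ∧ ‖A κ (T ν y)‖ ≤ a ∧ ‖A ν y‖ ≤ a) :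
    ‖deltaPrimeOp T (prodCfg U η A') η A μ x‖
      ≤ (14 * ((Fintype.card ι - 1 : ℕ) : ℝ)) * (Real.exp α₁ ^ 4 * ((1 + Real.exp α₁ ^ 4) / 2))
          * (Real.exp (6 * α₁) * (C₀ + 2 * α₁ + 18 * α₁ ^ 2)) * ((L ^ j * η) ^ 2)⁻¹ * a := by
  have e := eq369_prodCfg T U le_rfl hU1 hη hL hα hs μ x h37 h35 hA
  simpa only [mul_one] using e

end Eq369

/-! ## §6  Sanity instances: `U′ = 1` recovers `B9Eq369Small.eq369`; `U ≡ 1` is the pure-fluctuation plaquette -/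

section Examples

variable {𝔸 : Type*} [NormedRing 𝔸] [NormedAlgebra ℂ 𝔸] [CompleteSpace 𝔸] {S : Type*} {ι : Type*}
variable (T : ι → Equiv.Perm S) (U : ι → S → 𝔸ˣ)

/-- `A′ = 0`: the plaquette word collapses to the background plaquette. [folklore] -/
example (η : ℝ) (κ ν : ι) (y : S) : (plaqU T (prodCfg U η (0 : ι → S → 𝔸)) κ ν y : 𝔸) = plaqU T U κ ν y := by
  rw [prodCfg_zero]

/-- CONSISTENCY WITH THE LINEAGE LEAF: for `A′ = 0` (`U′ = 1`, `α₁ = 0`) the product-configuration theorem `eq369_prodCfg_group` IS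
`B9Eq369Small.eq369` (under the extra binders `0 < η`, `1 ≤ L` of the printed scale): `‖(Δ′A)(b)‖ ≤ 14(d − 1)·C₀·(L^jη)⁻²·a`.
[folklore] [cite: Balaban1985BackgroundPropagators, (3.69) p.404] -/
example [Fintype ι] [LinearOrder ι] (hU1 : ∀ μ x, ‖(U μ x : 𝔸)‖ ≤ 1 ∧ ‖(((U μ x)⁻¹ : 𝔸ˣ) : 𝔸)‖ ≤ 1) {A : ι → S → 𝔸}
    {η a C₀ L : ℝ} {j : ℕ} (hη : 0 < η) (hL : 1 ≤ L) (μ : ι) (x : S)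
    (hA : ∀ κ ν y, Through T μ x κ ν y → ‖A κ y‖ ≤ a ∧ ‖A ν (T κ y)‖ ≤ a ∧ ‖A κ (T ν y)‖ ≤ a ∧ ‖A ν y‖ ≤ a)
    (h35 : ∀ κ ν y, Through T μ x κ ν y → ‖(plaqU T U κ ν y : 𝔸) - 1‖ ≤ C₀ * ((L ^ j)⁻¹) ^ 2) :
    ‖deltaPrimeOp T U η A μ x‖ ≤ (14 * ((Fintype.card ι - 1 : ℕ) : ℝ)) * C₀ * ((L ^ j * η) ^ 2)⁻¹ * a := by
  have e := eq369_prodCfg_group T U hU1 hη hL le_rfl (A' := 0) (fun _ _ => by simp) μ x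
    (fun κ ν y _ => by simp) h35 hA
  rw [prodCfg_zero] at e
  refine e.trans (le_of_eq ?_)
  simp only [Real.exp_zero, one_pow, mul_zero, add_zero, zero_pow two_ne_zero]
  ring

/-- `U ≡ 1` (no background): the pure-fluctuation plaquette `U′(∂p) = e^{iηA′_κ(y)}e^{iηA′_ν(y+e_κ)}e^{−iηA′_κ(y+e_ν)}e^{−iηA′_ν(y)}`
satisfies `‖U′(∂p) − 1‖ ≤ η‖(D¹A′)(p)‖ + ½S(p)²η²e^{ηS(p)}` with the FLAT curl — B7 (52)'s shape. [folklore]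
[cite: Balaban1985BackgroundPropagators, (3.6) p.391] -/
example {η : ℝ} (hη : 0 ≤ η) (A : ι → S → 𝔸) (κ ν : ι) (y : S) :
    ‖(plaqU T (prodCfg (fun (_ : ι) (_ : S) => (1 : 𝔸ˣ)) η A) κ ν y : 𝔸) - 1‖
      ≤ η * ‖curl T (fun (_ : ι) (_ : S) => (1 : 𝔸ˣ)) A κ ν y‖
        + 1 / 2 * letterSize T (fun (_ : ι) (_ : S) => (1 : 𝔸ˣ)) A κ ν y ^ 2 * η ^ 2
            * Real.exp (η * letterSize T (fun (_ : ι) (_ : S) => (1 : 𝔸ˣ)) A κ ν y) := by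
  have e := norm_plaqU_prodCfg_sub_one_le T (fun (_ : ι) (_ : S) => (1 : 𝔸ˣ)) hη A κ ν y
  rw [plaqU_one, norm_zero, mul_zero, add_zero] at e
  exact e

/-- **IN THE GAUGE `u` OF (3.35)** (`U^u = e^{iηA}`, a pure-fluctuation configuration; flat derivative `∇^η`): the (3.35) letters
`‖A_κ(y)‖, ‖A_ν(y)‖ ≤ cℓ⁻¹`, `‖(D¹_κA_ν)(y)‖, ‖(D¹_νA_κ)(y)‖ ≤ η·cℓ⁻²` (`c = O(1)Mα₀`, `ℓ = L^jη ≥ η > 0`) give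
`‖U^u(∂p) − 1‖ ≤ e^{6cξ}(2c + 18c²)ξ²`, `ξ = η/ℓ` — the `O(1)Mα₀ξ²` of the background plaquette in the gauge `u` (the gauge
invariance `‖U(∂p) − 1‖ = ‖U^u(∂p) − 1‖` for unitary `u` is `B9Eq335Plaquette.norm_conj_sub_one_eq`, b09, not imported). [folklore]
[cite: Balaban1985BackgroundPropagators, (3.35) p.396] -/
theorem norm_fluct_plaq_sub_one_le_xi {η ℓ c : ℝ} (hη : 0 < η) (hηℓ : η ≤ ℓ) {A : ι → S → 𝔸} {κ ν : ι} {y : S}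
    (h₁ : ‖A κ y‖ ≤ c * ℓ⁻¹) (h₄ : ‖A ν y‖ ≤ c * ℓ⁻¹)
    (hDκ : ‖covD T (fun (_ : ι) (_ : S) => (1 : 𝔸ˣ)) κ (A ν) y‖ ≤ η * (c * (ℓ ^ 2)⁻¹))
    (hDν : ‖covD T (fun (_ : ι) (_ : S) => (1 : 𝔸ˣ)) ν (A κ) y‖ ≤ η * (c * (ℓ ^ 2)⁻¹)) :
    ‖(plaqU T (prodCfg (fun (_ : ι) (_ : S) => (1 : 𝔸ˣ)) η A) κ ν y : 𝔸) - 1‖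
      ≤ Real.exp (6 * c * (η / ℓ)) * (2 * c + 18 * c ^ 2) * (η / ℓ) ^ 2 := by
  have hP : ‖(plaqU T (fun (_ : ι) (_ : S) => (1 : 𝔸ˣ)) κ ν y : 𝔸) - 1‖ ≤ 0 * (η / ℓ) ^ 2 := by
    rw [plaqU_one, norm_zero, zero_mul]
  have e := norm_plaqU_prodCfg_sub_one_le_xi T (fun (_ : ι) (_ : S) => (1 : 𝔸ˣ)) hη hηℓ h₁ h₄ hDκ hDν hP
  rwa [zero_add] at e

/-- … and the flat covariant derivative there IS the forward difference `A_ν(y+e_κ) − A_ν(y)` (`= η·∇^η`). [folklore]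
[cite: Balaban1985BackgroundPropagators, p.390 (bottom)] -/
example (f : S → 𝔸) (κ : ι) (y : S) : covD T (fun (_ : ι) (_ : S) => (1 : 𝔸ˣ)) κ f y = f (T κ y) - f y := by
  simp [covD]

/-- The flat case has no transport: `S(p) = ‖A′_κ(y)‖ + ‖A′_ν(y+e_κ)‖ + ‖A′_κ(y+e_ν)‖ + ‖A′_ν(y)‖`. [folklore] -/
example (A : ι → S → 𝔸) (κ ν : ι) (y : S) :
    letterSize T (fun (_ : ι) (_ : S) => (1 : 𝔸ˣ)) A κ ν y = ‖A κ y‖ + ‖A ν (T κ y)‖ + ‖A κ (T ν y)‖ + ‖A ν y‖ := by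
  simp [letterSize]

end Examples

end Literature.MathematicalPhysics.QuantumFieldTheory.Balaban1983to89.B9Eq369Product
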